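import Literature.MathematicalPhysics.QuantumLattice.InfVolFermionStateLatticeMapPullback
import Literature.MathematicalPhysics.QuantumLattice.FermionEmbedLocality
import Literature.MathematicalPhysics.QuantumLattice.HubbardJordanWignerLocality
import Literature.MathematicalPhysics.QuantumLattice.FermionPartialTrace
import Literature.LinearAlgebra.Matrix.CommutingPosSemidefProduct
import HarnessLib

/-!
# Product states of the lattice fermion system: the product of EVEN infinite-volume states placed on
# the tiles of a tiling `K × ℤ^{d'} ≃ ℤ^d` (Araki–Moriya 2003, Theorem 11.2)

Topic `Literature/MathematicalPhysics/QuantumLattice` (namespace = path; family `hubbard`, model-free,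
general `d`, `d'`). Written for stage S2 («families of models») of the Hubbard material-oracle programme:
the CAP side of every «decoupled subsystems» transport rule — layered crystals (`ℤ^{d+1}` tiled by its
layers `ℤ^d`), bilayers / ladder arrays / decorated lattices (a lattice tiled by sublattices), films
(vacuum factors) — needs a translation-invariant TRIAL state of the composite system assembled from states
of the components, i.e. a PRODUCT STATE of the CAR algebra. Unlike spin systems, fermionic product states
do not exist for arbitrary factors (odd elements of disjoint regions anticommute); Araki–Moriya's
Theorem 11.2 constructs them when all factors (but at most one) are EVEN, which covers every
translation-invariant factor (`TranslationInvariantFermionStatesAreEven`). This file is that theorem in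
the tree's encoding of infinite-volume states (`InfVolFermionState`: compatible families of local
functionals), by Araki–Moriya's own device: on a finite region `Λ` the product functional is
`A ↦ τ(Π_k D_k · A)` where `τ` is the tracial state and `D_k = Γ_k(2^{|Orb|} ρ_k)` are the leg-embedded
ADJUSTED DENSITY MATRICES of the factors — even elements of disjoint regions, hence pairwise commuting,
hence with a positive product; the product property follows from the product property of `τ`
(`FermionTraceFactorization`) and graded commutativity (`FermionEmbedLocality`); compatibility with
isotony and uniqueness follow because class-sorted monomials are total.

## Contents

* §0 helpers: `trace_fermionEmbed` (`Γ` scales traces by the environment dimension), density matrices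
  of even states are `Θ`-even (`IsEven.parityAut_rdm`, Araki–Moriya Lemma 11.1), and the WORD CALCULUS:
  a generator anticommutes past a word avoiding its orbital, `wordOp_eq_sign_smul_filter_mul_filter`,
  **`wordOp_eq_sign_smul_prod_filter`** (class-sorting a word costs only a sign).
* §0b `normTrace` — the tracial state `τ = 2^{-|ι|} Tr`: product property over disjoint CAR subalgebras
  (`normTrace_mul_of_mem_carSubalgebra`), invariance under `Γ(φ)` (`normTrace_fermionEmbed`).
* §1 tilings `e : K × Site d' ≃ Site d`: legs `tileLeg e k = e (k, ·)`, `tileClass`, `tileCoord`, local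
  parts `tileLoc e Λ k = {y : e (k, y) ∈ Λ}`, `tileClasses`, the leg on ordered sites `PolySite.tileEmb`
  (second-quantised by `fermionEmbed`), class orbitals `tileOrbs` (disjoint for distinct classes).
* §2 factors: `InfVolFermionState.adjDensity` (`ν_X(a) = τ(D_X a)`), `tileFactor e ω Λ k = Γ_k(D_k)`:
  localised, even, positive, pairwise COMMUTING (`commute_tileFactor`), `τ(D_k Γ_k a) = ω_k(a)`.
* §3 `tileFactorProd` (`Finset.noncommProd` of the factors): even, positive
  (`Literature.LinearAlgebra.Matrix.posSemidef_mul_of_posSemidef_of_commute`), `τ = 1`, and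
  **`normTrace_tileFactorProd_mul_prod`** — THE PRODUCT FORMULA `τ(Π_S D_k · Π_i Γ_{k_i} a_i) = Π_i ω_{k_i}(a_i)`.
* §4 absent classes contribute `𝟙` (`tileFactorProd_eq_of_subset`); **every word factors through the
  legs up to a sign** (`exists_wordOp_eq_sign_smul_prod_fermionEmbed`).
* §5 **`InfVolFermionState.productState e ω hω : InfVolFermionState d`** — THE PRODUCT STATE (all four
  structure fields proved: normalisation, positivity, COMPATIBILITY WITH ISOTONY
  `tileExpect_fermionEmbed_incl`), with: the product property (`productState_expect_prod`, `_sigma`,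
  one tile `productState_expect_fermionEmbed`, two tiles `…_mul_fermionEmbed`, odd ⊗ any `= 0`);
  **the `k`-th marginal is `ω_k`** (`productState_mapAct`: `productState ∘ Γ_{leg k} = ω_k`); evenness;
  **uniqueness** (`eq_productState_of_forall_prod`); **translation covariance** (`productState_shift`:
  `(⊗ ω_k) ∘ τ_v = ⊗ (ω_{σ k} ∘ τ_{c_k})` when `τ_v` maps tile `k` onto tile `σ k` acting as `τ_{c_k}`
  in local coordinates) and `productState_isTranslationInvariant`; densities (`densityAt_productState`,
  with the general `densityAt_mapAct`).

Everything is PROVED (no `sorry`, no named fact). Definitions with bodies: `normTrace`, `tileLeg`,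
`tileClass`, `tileCoord`, `tileLoc`, `tileClasses`, `PolySite.tileEmb`, `tileOrbs`,
`InfVolFermionState.adjDensity`, `tileFactor`, `tileFactorProd`, `tileExpect`, `InfVolFermionState.productState`.
HONEST SCOPE: all factors even (Araki–Moriya allow one non-even factor; not needed for translation-invariant
factors and not constructed); no topology / no C⋆-inductive limit is used or needed (the tree's states are
compatible families of local functionals, so Araki–Moriya's Case 2 limiting argument is replaced by the
direct compatibility computation); nothing here is specific to any Hamiltonian — the energy bookkeeping of
layered / decorated models is the business of the sequel files.

## Tree / Mathlib search

REUSED: `fermionEmbed` + functoriality (`InfVolFermionState`), `carSubalgebra`, `carEvenSubalgebra`,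
`trace_mul_of_mem_carSubalgebra`, `commute_of_mem_carEvenSubalgebra`, `letterOp_mul_letterOp_of_ne`,
`mem_span_wordOp_of_mem_carSubalgebra`, `carSubalgebra_univ_eq_top` (`FermionTraceFactorization`,
`InfVolFermionState`), `fermionEmbed_mem_carSubalgebra/EvenSubalgebra`, `fermionEmbed_letterOp`
(`FermionEmbedLocality`), `JordanWigner.mem_carEvenSubalgebra_univ_of_parityAut_eq`
(`HubbardJordanWignerLocality`), `trace_mul_parityAut` (`FermionPartialTrace`), `posSemidef_fermionEmbed`
(`HubbardNNNHoppingClusterEmbedding`), `trace_jwEmbed`, `trace_relabel`, `mapAct`/`mapSet`/`PolySite.mapEmb`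
(`InfVolFermionStateLatticeMapPullback`), Mathlib `Finset.noncommProd` (+ `_insert_of_notMem`, `_commute`,
`_induction`, `map_noncommProd`), `Matrix.trace_single_mul`.
`lean search 'productState|tensorState|IsProductState|gradedTensor'`: nothing for the CAR algebra (only
qubit-register product vectors under `Literature/Computability`).

## References

* H. Araki, H. Moriya, *Equilibrium statistical mechanics of Fermion lattice systems*, Rev. Math. Phys. 15
  (2003) 93, §11.1: Lemma 11.1 (a state is even iff its adjusted density matrix is `Θ`-even) and
  **Theorem 11.2** (product state extension of even states on disjoint regions: existence via
  `ρ = ρ_n ⋯ ρ_1`, `φ(A) = τ(ρA)`, product property (11.4), uniqueness; Remark 1: Powers' thesis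
  Thm. 5.4; Remark 2: the product is even iff all factors are); §4.1 (tracial state, eq. (4.16); `Θ`,
  translations, even / invariant states, Def. 4.1–4.5). Held: `paper:arxiv-math-ph_0211016`, p. 37.
  [cite: ArakiMoriya2003, §11.1 Theorem 11.2]
* O. Bratteli, D. W. Robinson, *Operator Algebras and Quantum Statistical Mechanics 2*, 2nd ed. (1997),
  §5.2.2 (CAR algebra, graded commutation, the trace state is a product state).
  [cite: BratteliRobinsonII1997, §5.2.2]
* O. Bratteli, D. W. Robinson, vol. 1 (1987), §2.6 (density matrices of locally normal states), §4.3.1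
  (states composed with automorphisms). [cite: BratteliRobinsonI1987, §2.6 and §4.3.1]
-/

noncomputable section

namespace Literature.MathematicalPhysics.QuantumLattice

open Matrix Finset HubbardWave0 Literature.Probability.LatticeModels
open scoped ComplexOrder BigOperators

/-! ### §0. Helpers: traces under `Γ`, density matrices of even states, class-sorting of words -/

section Helpers

variable {Λ Λ' : Type*} [LinearOrder Λ] [Fintype Λ] [LinearOrder Λ'] [Fintype Λ']

/-- **`Γ(φ)` scales traces by the dimension of the environment**:
`Tr (Γ_φ a) = 2^{|Orb Λ'| − |Orb Λ|} · Tr a` (the normalised trace is preserved).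
[cite: BratteliRobinsonII1997, §5.2.2 (the trace state is a product state)] -/
theorem trace_fermionEmbed (φ : Λ ↪ Λ') (a : Matrix (Finset (Orb Λ)) (Finset (Orb Λ)) ℂ) :
    (fermionEmbed φ a).trace = 2 ^ (Fintype.card (Orb Λ') - Fintype.card (Orb Λ)) * a.trace := by
  rw [fermionEmbed_apply, trace_jwEmbed, trace_relabel, Fintype.card_congr (Orb.mapEquiv (rangeEquiv φ))]

/-- Normalised form: `Tr (Γ_φ a) / 2^{|Orb Λ'|} = Tr a / 2^{|Orb Λ|}`. [cite: BratteliRobinsonII1997, §5.2.2] -/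
theorem trace_fermionEmbed_div (φ : Λ ↪ Λ') (a : Matrix (Finset (Orb Λ)) (Finset (Orb Λ)) ℂ) :
    (fermionEmbed φ a).trace / 2 ^ Fintype.card (Orb Λ') = a.trace / 2 ^ Fintype.card (Orb Λ) := by
  have hle : Fintype.card (Orb Λ) ≤ Fintype.card (Orb Λ') := by
    rw [Fintype.card_congr (Orb.mapEquiv (rangeEquiv φ))]
    exact Fintype.card_le_of_embedding (orbEmb (rangeOrderEmb φ)).toEmbedding
  rw [trace_fermionEmbed, div_eq_iff (pow_ne_zero _ two_ne_zero), div_mul_eq_mul_div,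
    eq_div_iff (pow_ne_zero _ two_ne_zero), mul_comm (2 ^ _ : ℂ) a.trace, mul_assoc, ← pow_add,
    Nat.sub_add_cancel hle, mul_comm]

/-- Two matrices with the same trace pairing against every matrix are equal (uniqueness of the density
matrix of a functional on a full matrix algebra). [cite: NielsenChuang2010, §2.4.3 Box 2.6 eqs. (2.181)–(2.182)] -/
theorem eq_of_forall_trace_mul_eq {κ : Type*} [Fintype κ] [DecidableEq κ] {R R' : Matrix κ κ ℂ}
    (h : ∀ A : Matrix κ κ ℂ, (A * R).trace = (A * R').trace) : R = R' := by
  ext t s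
  have := h (Matrix.single s t 1)
  rwa [Matrix.trace_single_mul, Matrix.trace_single_mul, one_smul, one_smul] at this


/-- **The density matrices of an even state are even**: `Θ ρ_Λ = ρ_Λ` (Araki–Moriya 2003, Lemma 11.1:
a state is even iff its adjusted density matrix is `Θ`-even). [cite: ArakiMoriya2003, §11.1 Lemma 11.1] -/
theorem InfVolFermionState.IsEven.parityAut_rdm {d : ℕ} {ω : InfVolFermionState d} (hω : ω.IsEven)
    (X : Finset (Site d)) : parityAut (ω.rdm X) = ω.rdm X := by
  refine eq_of_forall_trace_mul_eq fun A => ?_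
  rw [trace_mul_parityAut, Matrix.trace_mul_comm, ω.trace_rdm_mul, hω X A, ← ω.trace_rdm_mul,
    Matrix.trace_mul_comm]

variable {ι : Type*} [LinearOrder ι] [Fintype ι]

/-- The operator of a concatenation of words is the product (list form of `wordOp_append`).
[cite: BratteliRobinsonII1997, §5.2.2] -/
theorem wordOp_flatten (ws : List (List (JWLetter ι))) : wordOp ws.flatten = (ws.map wordOp).prod := by
  induction ws with
  | nil => rw [List.flatten_nil, wordOp_nil, List.map_nil, List.prod_nil]
  | cons w ws ih => rw [List.flatten_cons, wordOp_append, ih, List.map_cons, List.prod_cons]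

/-- **A generator anticommutes past a word avoiding its orbital**: if no letter of `w` sits at the
orbital of `l`, then `c^♯_l · W = (-1)^{|w|} W · c^♯_l`. [cite: BratteliRobinsonII1997, §5.2.2 (5.2.11)–(5.2.12)] -/
theorem letterOp_mul_wordOp_of_forall_ne (l : JWLetter ι) (w : List (JWLetter ι))
    (h : ∀ l' ∈ w, l'.1 ≠ l.1) :
    letterOp l * wordOp w = (-1 : ℂ) ^ w.length • (wordOp w * letterOp l) := by
  induction w with
  | nil => rw [wordOp_nil, Matrix.mul_one, Matrix.one_mul, List.length_nil, pow_zero, one_smul]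
  | cons l' w ih =>
    have hl' : l.1 ≠ l'.1 := (h l' (List.mem_cons_self)).symm
    rw [wordOp_cons, ← Matrix.mul_assoc, letterOp_mul_letterOp_of_ne hl', Matrix.neg_mul,
      Matrix.mul_assoc, ih (fun m hm => h m (List.mem_cons_of_mem _ hm)), Matrix.mul_smul,
      ← Matrix.mul_assoc, List.length_cons, pow_succ, mul_neg_one, neg_smul]

/-- **Extracting a class of letters to the front**: if the letters of `w` satisfying `p` sit at
orbitals different from those of the letters not satisfying `p`, then
`W = ± W_p · W_{¬p}` (`W_p` the word of the `p`-letters in their original order).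
[cite: BratteliRobinsonII1997, §5.2.2 (graded commutation relations)] -/
theorem wordOp_eq_sign_smul_filter_mul_filter (p : JWLetter ι → Prop) [DecidablePred p]
    (w : List (JWLetter ι)) (h : ∀ l ∈ w, ∀ l' ∈ w, p l → ¬p l' → l.1 ≠ l'.1) :
    ∃ n : ℕ, wordOp w = (-1 : ℂ) ^ n • (wordOp (w.filter fun l => p l) * wordOp (w.filter fun l => ¬p l)) := by
  induction w with
  | nil => exact ⟨0, by rw [List.filter_nil, List.filter_nil, wordOp_nil, Matrix.mul_one, pow_zero, one_smul]⟩
  | cons l w ih =>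
    obtain ⟨n, hn⟩ := ih (fun m hm m' hm' => h m (List.mem_cons_of_mem _ hm) m' (List.mem_cons_of_mem _ hm'))
    by_cases hl : p l
    · refine ⟨n, ?_⟩
      rw [List.filter_cons_of_pos (by simpa using hl), List.filter_cons_of_neg (by simpa using hl),
        wordOp_cons, wordOp_cons, hn, Matrix.mul_smul, Matrix.mul_assoc]
    · refine ⟨n + (w.filter fun l => p l).length, ?_⟩
      have hne : ∀ l' ∈ w.filter (fun l => p l), l'.1 ≠ l.1 := by
        intro l' hl'
        rw [List.mem_filter] at hl'
        exact h l' (List.mem_cons_of_mem _ hl'.1) l List.mem_cons_self (by simpa using hl'.2) hl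
      rw [List.filter_cons_of_neg (by simpa using hl), List.filter_cons_of_pos (by simpa using hl),
        wordOp_cons, wordOp_cons, hn, Matrix.mul_smul, ← Matrix.mul_assoc,
        letterOp_mul_wordOp_of_forall_ne l _ hne, Matrix.smul_mul, Matrix.mul_assoc, smul_smul,
        ← pow_add]

variable {K : Type*} [DecidableEq K]

/-- **Class-sorting a word**: for a class function `c` on orbitals and a duplicate-free list `L`
of classes containing the classes of all letters of `w`, the word operator is, up to a sign, the
product over `k ∈ L` (in the order of `L`) of the word operators of the letters of class `k`
(each in its original order). [cite: BratteliRobinsonII1997, §5.2.2 (graded commutation relations)] -/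
theorem wordOp_eq_sign_smul_prod_filter (c : ι → K) (L : List K) (hL : L.Nodup) (w : List (JWLetter ι))
    (hw : ∀ l ∈ w, c l.1 ∈ L) :
    ∃ n : ℕ, wordOp w = (-1 : ℂ) ^ n • (L.map fun k => wordOp (w.filter fun l => c l.1 = k)).prod := by
  induction L generalizing w with
  | nil =>
    have hw0 : w = [] := List.eq_nil_iff_forall_not_mem.2 fun l hl => by simpa using hw l hl
    exact ⟨0, by rw [hw0, wordOp_nil, List.map_nil, List.prod_nil, pow_zero, one_smul]⟩
  | cons k L ih =>
    obtain ⟨n, hn⟩ := wordOp_eq_sign_smul_filter_mul_filter (fun l => c l.1 = k) w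
      (fun l _ l' _ hl hl' heq => hl' (by rw [← heq]; exact hl))
    have hk : k ∉ L := (List.nodup_cons.1 hL).1
    have hw' : ∀ l ∈ w.filter (fun l => ¬(c l.1 = k)), c l.1 ∈ L := by
      intro l hl
      rw [List.mem_filter] at hl
      have h1 := hw l hl.1
      rw [List.mem_cons] at h1
      exact h1.resolve_left (by simpa using hl.2)
    obtain ⟨m, hm⟩ := ih (List.nodup_cons.1 hL).2 _ hw'
    refine ⟨n + m, ?_⟩
    have hfilt : ∀ j ∈ L, (w.filter fun l => ¬(c l.1 = k)).filter (fun l => c l.1 = j) =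
        w.filter (fun l => c l.1 = j) := by
      intro j hj
      have hjk : j ≠ k := fun h => hk (h ▸ hj)
      rw [List.filter_filter]
      refine List.filter_congr fun l _ => ?_
      by_cases h : c l.1 = j
      · simp [h, hjk]
      · simp [h]
    rw [hn, hm, List.map_cons, List.prod_cons, Matrix.mul_smul, smul_smul, ← pow_add,
      List.map_congr_left (fun j hj => by rw [hfilt j hj])]

end Helpers


/-! ### §0b. The tracial state `τ = 2^{-|ι|} Tr` of the CAR algebra over the orbitals `ι` -/

section NormTrace

variable {ι : Type*} [LinearOrder ι] [Fintype ι]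

/-- **The tracial state** `τ(a) = Tr a / 2^{|ι|}` of the CAR algebra over the finite orbital set `ι`
(`Tr 𝟙 = 2^{|ι|}` on Fock space): the unique normalised trace, even, a product state over disjoint
regions (`normTrace_mul_of_mem_carSubalgebra`) and preserved by the structure maps `Γ(φ)`
(`normTrace_fermionEmbed`). Araki–Moriya (2003) §4.1 (the tracial state `τ` and its product
property (4.16)); Bratteli–Robinson II §5.2.2. [cite: ArakiMoriya2003, §4.1 (tracial state)] -/
def normTrace (a : Matrix (Finset ι) (Finset ι) ℂ) : ℂ := a.trace / 2 ^ Fintype.card ι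

omit [LinearOrder ι] in
/-- Unfolding `τ`. [cite: ArakiMoriya2003, §4.1] -/
theorem normTrace_apply (a : Matrix (Finset ι) (Finset ι) ℂ) : normTrace a = a.trace / 2 ^ Fintype.card ι := rfl

/-- `τ(𝟙) = 1`. [cite: ArakiMoriya2003, §4.1] -/
theorem normTrace_one : normTrace (1 : Matrix (Finset ι) (Finset ι) ℂ) = 1 := by
  rw [normTrace, Matrix.trace_one, Fintype.card_finset]
  push_cast
  exact div_self (pow_ne_zero _ two_ne_zero)

omit [LinearOrder ι] in
/-- `τ` is additive. [cite: ArakiMoriya2003, §4.1] -/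
theorem normTrace_add (a b : Matrix (Finset ι) (Finset ι) ℂ) : normTrace (a + b) = normTrace a + normTrace b := by
  rw [normTrace, normTrace, normTrace, Matrix.trace_add, add_div]

omit [LinearOrder ι] in
/-- `τ` is homogeneous. [cite: ArakiMoriya2003, §4.1] -/
theorem normTrace_smul (c : ℂ) (a : Matrix (Finset ι) (Finset ι) ℂ) : normTrace (c • a) = c * normTrace a := by
  rw [normTrace, normTrace, Matrix.trace_smul, smul_eq_mul, mul_div_assoc]

omit [LinearOrder ι] in
/-- `τ(ab) = τ(ba)`. [cite: ArakiMoriya2003, §4.1] -/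
theorem normTrace_mul_comm (a b : Matrix (Finset ι) (Finset ι) ℂ) : normTrace (a * b) = normTrace (b * a) := by
  rw [normTrace, normTrace, Matrix.trace_mul_comm]

/-- **Product property of the tracial state**: `τ(ab) = τ(a) τ(b)` for `a ∈ 𝔄(S₁)`, `b ∈ 𝔄(S₂)`,
`S₁ ∩ S₂ = ∅` (Araki–Moriya 2003 eq. (4.16)). [cite: ArakiMoriya2003, §4.1 eq. (4.16)] -/
theorem normTrace_mul_of_mem_carSubalgebra {S₁ S₂ : Finset ι} {a b : Matrix (Finset ι) (Finset ι) ℂ}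
    (ha : a ∈ carSubalgebra S₁) (hb : b ∈ carSubalgebra S₂) (hS : Disjoint S₁ S₂) :
    normTrace (a * b) = normTrace a * normTrace b := by
  rw [normTrace, normTrace, normTrace, div_mul_div_comm, ← trace_mul_of_mem_carSubalgebra ha hb hS,
    mul_div_mul_right _ _ (pow_ne_zero _ two_ne_zero)]

variable {Λ Λ' : Type*} [LinearOrder Λ] [Fintype Λ] [LinearOrder Λ'] [Fintype Λ']

/-- **`τ` is preserved by the structure maps**: `τ(Γ_φ a) = τ(a)`. [cite: ArakiMoriya2003, §4.1] -/
theorem normTrace_fermionEmbed (φ : Λ ↪ Λ') (a : Matrix (Finset (Orb Λ)) (Finset (Orb Λ)) ℂ) :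
    normTrace (fermionEmbed φ a) = normTrace a :=
  trace_fermionEmbed_div φ a

/-- `τ(A · Θ X) = τ(Θ A · X)`. [cite: ArakiMoriya2003, §4.1 Def. 4.2] -/
theorem normTrace_mul_parityAut (A X : Matrix (Finset ι) (Finset ι) ℂ) :
    normTrace (A * parityAut X) = normTrace (parityAut A * X) := by
  rw [normTrace, normTrace, trace_mul_parityAut]

end NormTrace

/-! ### §1. Tilings of `ℤ^d` by copies of `ℤ^{d'}`: classes, local coordinates, legs -/

section Tiling

variable {d d' : ℕ} {K : Type*} (e : K × Site d' ≃ Site d)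

/-- **The `k`-th leg** of the tiling `e : K × ℤ^{d'} ≃ ℤ^d`: the injection `y ↦ e (k, y)` of `ℤ^{d'}`
onto the `k`-th tile (layer `k` of a stack, sublattice `k` of a decoration, …).
[cite: ArakiMoriya2003, §11.1 (disjoint regions `I_i`)] -/
def tileLeg (k : K) : Site d' → Site d := fun y => e (k, y)

/-- Unfolding the leg. [cite: ArakiMoriya2003, §11.1] -/
@[simp] theorem tileLeg_apply (k : K) (y : Site d') : tileLeg e k y = e (k, y) := rfl

/-- Each leg is injective. [cite: ArakiMoriya2003, §11.1] -/
theorem tileLeg_injective (k : K) : Function.Injective (tileLeg e k) := fun y y' h => by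
  have := e.injective h
  exact (Prod.mk.inj this).2

/-- **The class** (tile index) of a site. [cite: ArakiMoriya2003, §11.1] -/
def tileClass (x : Site d) : K := (e.symm x).1

/-- **The local coordinate** of a site inside its tile. [cite: ArakiMoriya2003, §11.1] -/
def tileCoord (x : Site d) : Site d' := (e.symm x).2

/-- The class of a site of the `k`-th tile is `k`. [cite: ArakiMoriya2003, §11.1] -/
@[simp] theorem tileClass_tileLeg (k : K) (y : Site d') : tileClass e (tileLeg e k y) = k := by
  rw [tileClass, tileLeg_apply, Equiv.symm_apply_apply]

/-- The local coordinate of `e (k, y)` is `y`. [cite: ArakiMoriya2003, §11.1] -/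
@[simp] theorem tileCoord_tileLeg (k : K) (y : Site d') : tileCoord e (tileLeg e k y) = y := by
  rw [tileCoord, tileLeg_apply, Equiv.symm_apply_apply]

/-- Every site is the image of its local coordinate under the leg of its class. [cite: ArakiMoriya2003, §11.1] -/
theorem tileLeg_tileClass_tileCoord (x : Site d) : tileLeg e (tileClass e x) (tileCoord e x) = x := by
  rw [tileLeg_apply, tileClass, tileCoord, Prod.mk.eta, Equiv.apply_symm_apply]

/-- Sites of different classes differ; equivalently legs of different classes have disjoint images.
[cite: ArakiMoriya2003, §11.1] -/
theorem tileLeg_ne_tileLeg {k j : K} (h : k ≠ j) (y y' : Site d') : tileLeg e k y ≠ tileLeg e j y' := fun h' => by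
  have h1 := congrArg (tileClass e) h'
  rw [tileClass_tileLeg, tileClass_tileLeg] at h1
  exact h h1

/-- **The part of a region in tile `k`, in local coordinates**: `{y : e (k, y) ∈ Λ}`.
[cite: ArakiMoriya2003, §11.1 (the regions `I_i ∩ Λ`)] -/
def tileLoc (Λ : Finset (Site d)) (k : K) : Finset (Site d') :=
  Λ.preimage (tileLeg e k) (tileLeg_injective e k).injOn

/-- Membership in the local part. [cite: ArakiMoriya2003, §11.1] -/
@[simp] theorem mem_tileLoc {Λ : Finset (Site d)} {k : K} {y : Site d'} : y ∈ tileLoc e Λ k ↔ tileLeg e k y ∈ Λ :=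
  Finset.mem_preimage

/-- The local parts are monotone in the region. [cite: ArakiMoriya2003, §11.1] -/
theorem tileLoc_mono {Λ Λ' : Finset (Site d)} (h : Λ ⊆ Λ') (k : K) : tileLoc e Λ k ⊆ tileLoc e Λ' k :=
  fun _ hy => (mem_tileLoc e).2 (h ((mem_tileLoc e).1 hy))

/-- **The classes met by a region.** [cite: ArakiMoriya2003, §11.1] -/
def tileClasses [DecidableEq K] (Λ : Finset (Site d)) : Finset K := Λ.image (tileClass e)

/-- The class of a site of the region is met. [cite: ArakiMoriya2003, §11.1] -/
theorem tileClass_mem_tileClasses [DecidableEq K] {Λ : Finset (Site d)} {x : Site d} (hx : x ∈ Λ) :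
    tileClass e x ∈ tileClasses e Λ :=
  Finset.mem_image_of_mem _ hx

/-- The classes met are monotone in the region. [cite: ArakiMoriya2003, §11.1] -/
theorem tileClasses_mono [DecidableEq K] {Λ Λ' : Finset (Site d)} (h : Λ ⊆ Λ') : tileClasses e Λ ⊆ tileClasses e Λ' :=
  Finset.image_subset_image h

namespace PolySite

/-- **The `k`-th leg on ordered sites**: `y ↦ e (k, y)` from the ordered sites of the local part to
those of `Λ`; its second quantisation `Γ` embeds the local CAR algebra of the `k`-th tile.
[cite: ArakiMoriya2003, §4.1 Def. 4.1 (2)] -/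
def tileEmb (Λ : Finset (Site d)) (k : K) : PolySite (tileLoc e Λ k) ↪ PolySite Λ :=
  ⟨fun y => pt (tileLeg e k (ofLex y.1)) ((mem_tileLoc e).1 (ofLex_mem y)),
    fun y y' hy => by
      have h : tileLeg e k (ofLex y.1) = tileLeg e k (ofLex y'.1) :=
        congrArg (fun z : PolySite Λ => ofLex z.1) hy
      exact Subtype.ext (congrArg toLex (tileLeg_injective e k h))⟩

/-- `tileEmb` on a site. [cite: ArakiMoriya2003, §4.1] -/
@[simp] theorem tileEmb_pt (Λ : Finset (Site d)) (k : K) (y : Site d') (hy : y ∈ tileLoc e Λ k) :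
    tileEmb e Λ k (pt y hy) = pt (tileLeg e k y) ((mem_tileLoc e).1 hy) := rfl

/-- Underlying ordered site of a leg image. [cite: ArakiMoriya2003, §4.1] -/
@[simp] theorem coe_tileEmb_eq (Λ : Finset (Site d)) (k : K) (y : PolySite (tileLoc e Λ k)) :
    (tileEmb e Λ k y).1 = toLex (tileLeg e k (ofLex y.1)) := rfl

end PolySite

/-- **The orbitals of class `k` of a region** (the image orbitals of the `k`-th leg).
[cite: ArakiMoriya2003, §4.1 Def. 4.1 (2)] -/
def tileOrbs (Λ : Finset (Site d)) (k : K) : Finset (Orb (PolySite Λ)) :=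
  orbs ((Finset.univ : Finset (PolySite (tileLoc e Λ k))).map (PolySite.tileEmb e Λ k))

/-- An orbital is of class `k` iff its site is. [cite: ArakiMoriya2003, §4.1] -/
theorem mem_tileOrbs_iff {Λ : Finset (Site d)} {k : K} {i : Orb (PolySite Λ)} :
    i ∈ tileOrbs e Λ k ↔ tileClass e (ofLex (ofLex i).1.1) = k := by
  rw [tileOrbs, mem_orbs, Finset.mem_map]
  constructor
  · rintro ⟨y, -, hy⟩
    rw [← hy, PolySite.coe_tileEmb_eq, ofLex_toLex, tileClass_tileLeg]
  · intro h
    have hx : ofLex (ofLex i).1.1 ∈ Λ := PolySite.ofLex_mem _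
    have hy : tileCoord e (ofLex (ofLex i).1.1) ∈ tileLoc e Λ k := by
      rw [mem_tileLoc, ← h, tileLeg_tileClass_tileCoord]; exact hx
    refine ⟨PolySite.pt _ hy, Finset.mem_univ _, Subtype.ext ?_⟩
    rw [PolySite.coe_tileEmb_eq, PolySite.ofLex_coe_pt, ← h, tileLeg_tileClass_tileCoord, toLex_ofLex]

/-- Every orbital of the region lies in the orbitals of its class. [cite: ArakiMoriya2003, §4.1] -/
theorem mem_tileOrbs_tileClass {Λ : Finset (Site d)} (i : Orb (PolySite Λ)) :
    i ∈ tileOrbs e Λ (tileClass e (ofLex (ofLex i).1.1)) :=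
  (mem_tileOrbs_iff e).2 rfl

/-- Orbitals of different classes are disjoint. [cite: ArakiMoriya2003, §11.1 (mutually disjoint regions)] -/
theorem disjoint_tileOrbs {Λ : Finset (Site d)} {k j : K} (h : k ≠ j) : Disjoint (tileOrbs e Λ k) (tileOrbs e Λ j) :=
  Finset.disjoint_left.2 fun _ hi hj => h (((mem_tileOrbs_iff e).1 hi).symm.trans ((mem_tileOrbs_iff e).1 hj))

/-- The orbitals of class `k` are disjoint from those of any set of classes not containing `k`.
[cite: ArakiMoriya2003, §11.1] -/
theorem disjoint_tileOrbs_biUnion [DecidableEq K] {Λ : Finset (Site d)} {k : K} {S : Finset K} (h : k ∉ S) :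
    Disjoint (tileOrbs e Λ k) (S.biUnion (tileOrbs e Λ)) :=
  Finset.disjoint_biUnion_right _ _ _ |>.2 fun j hj => disjoint_tileOrbs e fun hkj : k = j => h (hkj ▸ hj)

end Tiling

/-! ### §2. The factors: adjusted density matrices of the component states, embedded by the legs -/

section Factors

variable {d d' : ℕ} {K : Type*} (e : K × Site d' ≃ Site d)

namespace InfVolFermionState

/-- **The adjusted density matrix** `D_X = 2^{|Orb X|} ρ_X` of the restriction of `ν` to the region
`X`, normalised against the tracial state: `ν_X(a) = τ(D_X a)` (`normTrace_adjDensity_mul`).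
Araki–Moriya (2003) Lemma 11.1 / proof of Thm. 11.2 ("adjusted density matrix").
[cite: ArakiMoriya2003, §11.1 Lemma 11.1] -/
def adjDensity (ν : InfVolFermionState d') (X : Finset (Site d')) : FermionOp X :=
  ((2 : ℂ) ^ Fintype.card (Orb (PolySite X))) • ν.rdm X

/-- `ν_X(a) = τ(D_X a)`. [cite: ArakiMoriya2003, §11.1 Lemma 11.1] -/
theorem normTrace_adjDensity_mul (ν : InfVolFermionState d') (X : Finset (Site d')) (A : FermionOp X) :
    normTrace (ν.adjDensity X * A) = ν.expect X A := by
  rw [adjDensity, Matrix.smul_mul, normTrace_smul, normTrace_apply, trace_rdm_mul, mul_div_assoc',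
    mul_div_cancel_left₀ _ (pow_ne_zero _ two_ne_zero)]

/-- `τ(D_X) = 1`. [cite: ArakiMoriya2003, §11.1] -/
theorem normTrace_adjDensity (ν : InfVolFermionState d') (X : Finset (Site d')) : normTrace (ν.adjDensity X) = 1 := by
  rw [← Matrix.mul_one (ν.adjDensity X), normTrace_adjDensity_mul, ν.expect_one]

/-- The adjusted density matrix of an EVEN state is `Θ`-even (Araki–Moriya Lemma 11.1).
[cite: ArakiMoriya2003, §11.1 Lemma 11.1] -/
theorem parityAut_adjDensity {ν : InfVolFermionState d'} (hν : ν.IsEven) (X : Finset (Site d')) :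
    parityAut (ν.adjDensity X) = ν.adjDensity X := by
  rw [adjDensity, map_smul, hν.parityAut_rdm]

/-- The adjusted density matrix is positive semidefinite. [cite: ArakiMoriya2003, §11.1] -/
theorem posSemidef_adjDensity (ν : InfVolFermionState d') (X : Finset (Site d')) : (ν.adjDensity X).PosSemidef :=
  (ν.rdm_posSemidef X).smul (pow_nonneg zero_le_two _)

end InfVolFermionState

/-- **The `k`-th factor on the region `Λ`**: the adjusted density matrix of `ω_k` on the local part
`tileLoc e Λ k`, embedded into `𝔄_Λ` by the `k`-th leg (`ρ_i` of Araki–Moriya's proof of Thm. 11.2).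
[cite: ArakiMoriya2003, §11.1 Theorem 11.2 (proof, Case 1)] -/
def tileFactor (ω : K → InfVolFermionState d') (Λ : Finset (Site d)) (k : K) : FermionOp Λ :=
  fermionEmbed (PolySite.tileEmb e Λ k) ((ω k).adjDensity (tileLoc e Λ k))

variable (ω : K → InfVolFermionState d')

/-- The `k`-th factor is localised on the orbitals of class `k`. [cite: ArakiMoriya2003, §11.1 Theorem 11.2] -/
theorem tileFactor_mem_carSubalgebra (Λ : Finset (Site d)) (k : K) :
    tileFactor e ω Λ k ∈ carSubalgebra (tileOrbs e Λ k) :=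
  fermionEmbed_mem_carSubalgebra _ _

/-- For an even component state the `k`-th factor is an EVEN element localised on the orbitals of
class `k`. [cite: ArakiMoriya2003, §11.1 Theorem 11.2 (`ρ_i ∈ 𝔄(I_i)₊`)] -/
theorem tileFactor_mem_carEvenSubalgebra {ω : K → InfVolFermionState d'} {k : K} (hω : (ω k).IsEven)
    (Λ : Finset (Site d)) : tileFactor e ω Λ k ∈ carEvenSubalgebra (tileOrbs e Λ k) :=
  fermionEmbed_mem_carEvenSubalgebra _
    (JordanWigner.mem_carEvenSubalgebra_univ_of_parityAut_eq (InfVolFermionState.parityAut_adjDensity hω _))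

/-- The factors are `Θ`-even for even component states. [cite: ArakiMoriya2003, §11.1 Lemma 11.1] -/
theorem parityAut_tileFactor {ω : K → InfVolFermionState d'} {k : K} (hω : (ω k).IsEven) (Λ : Finset (Site d)) :
    parityAut (tileFactor e ω Λ k) = tileFactor e ω Λ k := by
  rw [tileFactor, ← fermionEmbed_parityAut, InfVolFermionState.parityAut_adjDensity hω]

/-- The factors are positive semidefinite. [cite: ArakiMoriya2003, §11.1 Theorem 11.2] -/
theorem posSemidef_tileFactor (Λ : Finset (Site d)) (k : K) : (tileFactor e ω Λ k).PosSemidef :=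
  posSemidef_fermionEmbed _ (InfVolFermionState.posSemidef_adjDensity _ _)

/-- **The factors of even component states commute pairwise** (even elements of disjoint regions).
[cite: ArakiMoriya2003, §11.1 Theorem 11.2 ("each `ρ_i` commutes with any `ρ_j`")] -/
theorem commute_tileFactor {ω : K → InfVolFermionState d'} (hω : ∀ k, (ω k).IsEven) (Λ : Finset (Site d)) (k j : K) :
    Commute (tileFactor e ω Λ k) (tileFactor e ω Λ j) := by
  by_cases h : k = j
  · subst h; exact Commute.refl _
  · exact commute_of_mem_carEvenSubalgebra (tileFactor_mem_carEvenSubalgebra e (hω k) Λ)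
      (tileFactor_mem_carSubalgebra e ω Λ j) (disjoint_tileOrbs e h)

/-- **`τ(D_k · Γ_k a) = ω_k(a)`**: against an observable of its own tile the `k`-th factor reproduces
the component state. [cite: ArakiMoriya2003, §11.1 Theorem 11.2 (`τ(A_n ρ_n) = φ_n(A_n)`)] -/
theorem normTrace_tileFactor_mul_fermionEmbed (Λ : Finset (Site d)) (k : K) (a : FermionOp (tileLoc e Λ k)) :
    normTrace (tileFactor e ω Λ k * fermionEmbed (PolySite.tileEmb e Λ k) a) = (ω k).expect (tileLoc e Λ k) a := by
  rw [tileFactor, ← map_mul, normTrace_fermionEmbed, InfVolFermionState.normTrace_adjDensity_mul]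

/-- `τ(D_k) = 1`. [cite: ArakiMoriya2003, §11.1 Theorem 11.2] -/
theorem normTrace_tileFactor (Λ : Finset (Site d)) (k : K) : normTrace (tileFactor e ω Λ k) = 1 := by
  rw [tileFactor, normTrace_fermionEmbed, InfVolFermionState.normTrace_adjDensity]

end Factors

/-! ### §3. The product density matrix `Π_k D_k` and the product functional `A ↦ τ(Π_k D_k · A)` -/

section Product

variable {d d' : ℕ} {K : Type*} [DecidableEq K] (e : K × Site d' ≃ Site d)
  (ω : K → InfVolFermionState d') (hω : ∀ k, (ω k).IsEven)

/-- **The product of the factors over a finite set of classes** (well defined: the factors commute).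
[cite: ArakiMoriya2003, §11.1 Theorem 11.2 eq. (11.5) (`ρ = ρ_n ⋯ ρ_1`)] -/
def tileFactorProd (Λ : Finset (Site d)) (S : Finset K) : FermionOp Λ :=
  S.noncommProd (tileFactor e ω Λ) fun k _ j _ _ => commute_tileFactor e hω Λ k j

/-- Splitting off one factor: `Π_S = D_k · Π_{S ∖ k}` for `k ∈ S`. [cite: ArakiMoriya2003, §11.1 Theorem 11.2] -/
theorem tileFactorProd_eq_mul_erase (Λ : Finset (Site d)) {S : Finset K} {k : K} (hk : k ∈ S) :
    tileFactorProd e ω hω Λ S = tileFactor e ω Λ k * tileFactorProd e ω hω Λ (S.erase k) := by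
  rw [tileFactorProd, tileFactorProd, ← Finset.noncommProd_insert_of_notMem _ _ _ _ (Finset.notMem_erase k S)]
  exact Finset.noncommProd_congr (Finset.insert_erase hk).symm (fun _ _ => rfl) _

omit [DecidableEq K] in
/-- The empty product is `𝟙`. [cite: ArakiMoriya2003, §11.1] -/
theorem tileFactorProd_empty (Λ : Finset (Site d)) : tileFactorProd e ω hω Λ ∅ = 1 :=
  Finset.noncommProd_empty _ _

omit [DecidableEq K] in
/-- The product over `S` is an even element localised on the orbitals of the classes in `S`.
[cite: ArakiMoriya2003, §11.1 Theorem 11.2] -/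
theorem tileFactorProd_mem_carEvenSubalgebra (Λ : Finset (Site d)) (S : Finset K) :
    tileFactorProd e ω hω Λ S ∈ carEvenSubalgebra (S.biUnion (tileOrbs e Λ)) := by
  refine Finset.noncommProd_induction S _ _ (· ∈ carEvenSubalgebra (S.biUnion (tileOrbs e Λ)))
    (fun a b ha hb => Subalgebra.mul_mem _ ha hb) (Subalgebra.one_mem _) fun k hk => ?_
  exact carEvenSubalgebra_mono (Finset.subset_biUnion_of_mem _ hk) (tileFactor_mem_carEvenSubalgebra e (hω k) Λ)

omit [DecidableEq K] in
/-- … in particular localised on those orbitals. [cite: ArakiMoriya2003, §11.1 Theorem 11.2] -/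
theorem tileFactorProd_mem_carSubalgebra (Λ : Finset (Site d)) (S : Finset K) :
    tileFactorProd e ω hω Λ S ∈ carSubalgebra (S.biUnion (tileOrbs e Λ)) :=
  carEvenSubalgebra_le_carSubalgebra _ (tileFactorProd_mem_carEvenSubalgebra e ω hω Λ S)

/-- **The product is positive semidefinite** (a product of commuting positive semidefinite matrices).
[cite: ArakiMoriya2003, §11.1 Theorem 11.2 ("a product of mutually commuting non-negative hermitian operators and hence it is positive")] -/
theorem posSemidef_tileFactorProd (Λ : Finset (Site d)) (S : Finset K) : (tileFactorProd e ω hω Λ S).PosSemidef := by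
  induction S using Finset.induction_on with
  | empty => rw [tileFactorProd_empty]; exact Matrix.PosSemidef.one
  | insert k S hk ih =>
    rw [tileFactorProd_eq_mul_erase e ω hω Λ (Finset.mem_insert_self k S), Finset.erase_insert hk]
    refine Literature.LinearAlgebra.Matrix.posSemidef_mul_of_posSemidef_of_commute (posSemidef_tileFactor e ω Λ k) ih ?_
    exact Finset.noncommProd_commute _ _ _ _ fun j _ => commute_tileFactor e hω Λ k j

omit [DecidableEq K] in
/-- The product is `Θ`-even. [cite: ArakiMoriya2003, §11.1 Lemma 11.1] -/
theorem parityAut_tileFactorProd (Λ : Finset (Site d)) (S : Finset K) :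
    parityAut (tileFactorProd e ω hω Λ S) = tileFactorProd e ω hω Λ S := by
  rw [tileFactorProd, Finset.map_noncommProd]
  exact Finset.noncommProd_congr rfl (fun k _ => parityAut_tileFactor e (hω k) Λ) _

/-- **`τ(Π_S D_k) = 1`** (product property of the tracial state). [cite: ArakiMoriya2003, §11.1 Theorem 11.2 ("This also shows `φ(𝟙) = 1`")] -/
theorem normTrace_tileFactorProd (Λ : Finset (Site d)) (S : Finset K) : normTrace (tileFactorProd e ω hω Λ S) = 1 := by
  induction S using Finset.induction_on with
  | empty => rw [tileFactorProd_empty, normTrace_one]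
  | insert k S hk ih =>
    rw [tileFactorProd_eq_mul_erase e ω hω Λ (Finset.mem_insert_self k S), Finset.erase_insert hk,
      normTrace_mul_of_mem_carSubalgebra (tileFactor_mem_carSubalgebra e ω Λ k)
        (tileFactorProd_mem_carSubalgebra e ω hω Λ S) (disjoint_tileOrbs_biUnion e hk),
      normTrace_tileFactor, ih, mul_one]

omit [DecidableEq K] in
/-- A list product of leg-embedded observables of tiles with classes in `S` is localised on the orbitals
of `S`. [cite: ArakiMoriya2003, §11.1] -/
theorem prod_map_fermionEmbed_mem_carSubalgebra (Λ : Finset (Site d)) {S : Finset K}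
    (L : List (Σ k : K, FermionOp (tileLoc e Λ k))) (hLS : ∀ p ∈ L, p.1 ∈ S) :
    (L.map fun p => fermionEmbed (PolySite.tileEmb e Λ p.1) p.2).prod ∈ carSubalgebra (S.biUnion (tileOrbs e Λ)) := by
  induction L with
  | nil => rw [List.map_nil, List.prod_nil]; exact Subalgebra.one_mem _
  | cons p L ih =>
    rw [List.map_cons, List.prod_cons]
    exact Subalgebra.mul_mem _
      (carSubalgebra_mono (Finset.subset_biUnion_of_mem _ (hLS p List.mem_cons_self)) (fermionEmbed_mem_carSubalgebra _ _))
      (ih fun q hq => hLS q (List.mem_cons_of_mem _ hq))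

/-- **THE PRODUCT FORMULA** (Araki–Moriya Thm. 11.2 (11.4)): against a product of observables of
DISTINCT tiles (a list of pairs (class, observable of that tile), classes pairwise distinct, each
observable embedded by its leg) the product density reproduces the product of the component
expectations, `τ(Π_S D_k · Π_i Γ_{k_i} a_i) = Π_i ω_{k_i}(a_i)`.
[cite: ArakiMoriya2003, §11.1 Theorem 11.2 eq. (11.4)] -/
theorem normTrace_tileFactorProd_mul_prod (Λ : Finset (Site d)) (S : Finset K)
    (L : List (Σ k : K, FermionOp (tileLoc e Λ k))) (hL : (L.map Sigma.fst).Nodup) (hLS : ∀ p ∈ L, p.1 ∈ S) :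
    normTrace (tileFactorProd e ω hω Λ S * (L.map fun p => fermionEmbed (PolySite.tileEmb e Λ p.1) p.2).prod) =
      (L.map fun p => (ω p.1).expect (tileLoc e Λ p.1) p.2).prod := by
  induction L generalizing S with
  | nil => rw [List.map_nil, List.prod_nil, Matrix.mul_one, normTrace_tileFactorProd, List.map_nil, List.prod_nil]
  | cons p L ih =>
    rw [List.map_cons, List.nodup_cons] at hL
    have hkS : p.1 ∈ S := hLS p List.mem_cons_self
    have hLS' : ∀ q ∈ L, q.1 ∈ S.erase p.1 := fun q hq =>
      Finset.mem_erase.2 ⟨fun h => hL.1 (h ▸ List.mem_map_of_mem hq), hLS q (List.mem_cons_of_mem _ hq)⟩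
    -- abbreviations
    set X := tileFactor e ω Λ p.1
    set P := tileFactorProd e ω hω Λ (S.erase p.1)
    set A := fermionEmbed (PolySite.tileEmb e Λ p.1) p.2
    set Q := (L.map fun q => fermionEmbed (PolySite.tileEmb e Λ q.1) q.2).prod
    have hP : P ∈ carEvenSubalgebra ((S.erase p.1).biUnion (tileOrbs e Λ)) :=
      tileFactorProd_mem_carEvenSubalgebra e ω hω Λ _
    have hA : A ∈ carSubalgebra (tileOrbs e Λ p.1) := fermionEmbed_mem_carSubalgebra _ _
    have hQ : Q ∈ carSubalgebra ((S.erase p.1).biUnion (tileOrbs e Λ)) :=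
      prod_map_fermionEmbed_mem_carSubalgebra e Λ L hLS'
    have hdisj : Disjoint (tileOrbs e Λ p.1) ((S.erase p.1).biUnion (tileOrbs e Λ)) :=
      disjoint_tileOrbs_biUnion e (Finset.notMem_erase p.1 S)
    have hPA : Commute P A := commute_of_mem_carEvenSubalgebra hP hA hdisj.symm
    rw [List.map_cons, List.prod_cons, tileFactorProd_eq_mul_erase e ω hω Λ hkS]
    calc normTrace (X * P * (A * Q))
        = normTrace ((X * A) * (P * Q)) := by rw [Matrix.mul_assoc, ← Matrix.mul_assoc P, hPA.eq]; simp only [Matrix.mul_assoc]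
      _ = normTrace (X * A) * normTrace (P * Q) :=
          normTrace_mul_of_mem_carSubalgebra (Subalgebra.mul_mem _ (tileFactor_mem_carSubalgebra e ω Λ p.1) hA)
            (Subalgebra.mul_mem _ (carEvenSubalgebra_le_carSubalgebra _ hP) hQ) hdisj
      _ = (ω p.1).expect (tileLoc e Λ p.1) p.2 * (L.map fun q => (ω q.1).expect (tileLoc e Λ q.1) q.2).prod := by
          rw [normTrace_tileFactor_mul_fermionEmbed, ih (S.erase p.1) hL.2 hLS']
      _ = _ := by rw [List.map_cons, List.prod_cons]

end Product

/-! ### §4. Words factor through the legs; the product functional is compatible with isotony -/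

section Words

variable {d d' : ℕ} {K : Type*} [DecidableEq K] (e : K × Site d' ≃ Site d)
  (ω : K → InfVolFermionState d') (hω : ∀ k, (ω k).IsEven)

/-- On a local part WITHOUT sites the adjusted density matrix is `𝟙` (a `1 × 1` matrix with entry
`ν(𝟙) = 1`). [cite: ArakiMoriya2003, §11.1] -/
theorem InfVolFermionState.adjDensity_eq_one_of_isEmpty (ν : InfVolFermionState d') (X : Finset (Site d'))
    [hX : IsEmpty (PolySite X)] : ν.adjDensity X = 1 := by
  haveI : IsEmpty (Orb (PolySite X)) := ⟨fun i => isEmptyElim (ofLex i).1⟩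
  have hcard : Fintype.card (Orb (PolySite X)) = 0 := Fintype.card_eq_zero
  have huniq : ∀ s : Finset (Orb (PolySite X)), s = ∅ := fun s =>
    Finset.eq_empty_of_forall_notMem fun i _ => isEmptyElim i
  ext s t
  rw [huniq s, huniq t, InfVolFermionState.adjDensity, hcard, pow_zero, one_smul, InfVolFermionState.rdm_apply,
    Matrix.one_apply_eq]
  have h1 : (Matrix.single ∅ ∅ (1 : ℂ) : FermionOp X) = 1 := by
    ext u v
    rw [huniq u, huniq v, Matrix.single_apply_same, Matrix.one_apply_eq]
  rw [h1, ν.expect_one]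

omit [DecidableEq K] in
/-- A class with empty local part contributes the factor `𝟙`. [cite: ArakiMoriya2003, §11.1] -/
theorem tileFactor_eq_one {Λ : Finset (Site d)} {k : K} (h : tileLoc e Λ k = ∅) : tileFactor e ω Λ k = 1 := by
  haveI : IsEmpty (PolySite (tileLoc e Λ k)) :=
    ⟨fun y => Finset.eq_empty_iff_forall_notMem.1 h _ (PolySite.ofLex_mem y)⟩
  rw [tileFactor, InfVolFermionState.adjDensity_eq_one_of_isEmpty, fermionEmbed_one]

/-- A class absent from a region has empty local part there. [cite: ArakiMoriya2003, §11.1] -/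
theorem tileLoc_eq_empty_of_notMem {Λ : Finset (Site d)} {k : K} (hk : k ∉ tileClasses e Λ) : tileLoc e Λ k = ∅ :=
  Finset.eq_empty_of_forall_notMem fun y hy => hk (by
    have := tileClass_mem_tileClasses e ((mem_tileLoc e).1 hy)
    rwa [tileClass_tileLeg] at this)

/-- **The product does not see absent classes**: enlarging the set of classes by classes absent
from the region does not change the product density. [cite: ArakiMoriya2003, §11.1 Theorem 11.2] -/
theorem tileFactorProd_eq_of_subset (Λ : Finset (Site d)) {S T : Finset K} (hTS : T ⊆ S)
    (hS : ∀ k ∈ S, k ∉ T → tileLoc e Λ k = ∅) : tileFactorProd e ω hω Λ S = tileFactorProd e ω hω Λ T := by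
  induction S using Finset.induction_on generalizing T with
  | empty => rw [Finset.subset_empty.1 hTS]
  | insert k S hk ih =>
    by_cases hkT : k ∈ T
    · rw [tileFactorProd_eq_mul_erase e ω hω Λ (Finset.mem_insert_self k S), Finset.erase_insert hk,
        tileFactorProd_eq_mul_erase e ω hω Λ hkT]
      congr 1
      refine ih (fun j hj => ?_) (fun j hjS hjT => ?_)
      · have hjk : j ≠ k := Finset.ne_of_mem_erase hj
        exact (Finset.mem_insert.1 (hTS (Finset.mem_of_mem_erase hj))).resolve_left hjk
      · have hjk : j ≠ k := fun h => hk (h ▸ hjS)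
        exact hS j (Finset.mem_insert_of_mem hjS) fun hjT' => hjT (Finset.mem_erase.2 ⟨hjk, hjT'⟩)
    · rw [tileFactorProd_eq_mul_erase e ω hω Λ (Finset.mem_insert_self k S), Finset.erase_insert hk,
        tileFactor_eq_one e ω (hS k (Finset.mem_insert_self k S) hkT), Matrix.one_mul,
        ih (fun j hj => (Finset.mem_insert.1 (hTS hj)).resolve_left (fun h => hkT (h ▸ hj)))
          (fun j hjS hjT => hS j (Finset.mem_insert_of_mem hjS) hjT)]

/-- **Every word factors through the legs, up to a sign**: for a duplicate-free list `L` of classes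
containing all classes met by `Λ`, the operator of any word in the generators of `𝔄_Λ` is
`± Π_{k ∈ L} Γ_k(a_k)` with `a_k ∈ 𝔄_{tileLoc k}` (the class-`k` letters, pulled back along the leg).
[cite: ArakiMoriya2003, §11.1 Theorem 11.2 ("the monomials … are total in `𝔄(I)`")] -/
theorem exists_wordOp_eq_sign_smul_prod_fermionEmbed (Λ : Finset (Site d)) (L : List K) (hL : L.Nodup)
    (hΛL : ∀ x ∈ Λ, tileClass e x ∈ L) (w : List (JWLetter (Orb (PolySite Λ)))) :
    ∃ (n : ℕ) (a : (k : K) → FermionOp (tileLoc e Λ k)),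
      wordOp w = (-1 : ℂ) ^ n • (L.map fun k => fermionEmbed (PolySite.tileEmb e Λ k) (a k)).prod := by
  -- class-sort the word
  obtain ⟨n, hn⟩ := wordOp_eq_sign_smul_prod_filter (fun i : Orb (PolySite Λ) => tileClass e (ofLex (ofLex i).1.1))
    L hL w (fun l _ => hΛL _ (PolySite.ofLex_mem _))
  -- lift the class-`k` subword along the `k`-th leg
  have hlift : ∀ k : K, ∀ v : List (JWLetter (Orb (PolySite Λ))),
      (∀ l ∈ v, tileClass e (ofLex (ofLex l.1).1.1) = k) →
        ∃ u : List (JWLetter (Orb (PolySite (tileLoc e Λ k)))), fermionEmbed (PolySite.tileEmb e Λ k) (wordOp u) = wordOp v := by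
    intro k v hv
    induction v with
    | nil => exact ⟨[], by rw [wordOp_nil, fermionEmbed_one, wordOp_nil]⟩
    | cons l v ih =>
      obtain ⟨u, hu⟩ := ih fun m hm => hv m (List.mem_cons_of_mem _ hm)
      have hk := hv l List.mem_cons_self
      -- the site of `l` in local coordinates
      have hy : tileCoord e (ofLex (ofLex l.1).1.1) ∈ tileLoc e Λ k := by
        rw [mem_tileLoc, ← hk, tileLeg_tileClass_tileCoord]; exact PolySite.ofLex_mem _
      refine ⟨(orb (PolySite.pt _ hy) (ofLex l.1).2, l.2) :: u, ?_⟩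
      rw [wordOp_cons, fermionEmbed_mul, hu, wordOp_cons, fermionEmbed_letterOp]
      congr 2
      simp only [ofLex_toLex]
      have hsite : PolySite.tileEmb e Λ k (PolySite.pt _ hy) = (ofLex l.1).1 := by
        apply Subtype.ext
        rw [PolySite.coe_tileEmb_eq, PolySite.ofLex_coe_pt, ← hk, tileLeg_tileClass_tileCoord, toLex_ofLex]
      rw [hsite]
      rfl
  choose u hu using fun k => hlift k (w.filter fun l => tileClass e (ofLex (ofLex l.1).1.1) = k)
    (fun l hl => by simpa using (List.mem_filter.1 hl).2)
  refine ⟨n, fun k => wordOp (u k), ?_⟩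
  rw [hn]
  congr 1
  exact congrArg List.prod (List.map_congr_left fun k _ => (hu k).symm)

end Words

/-! ### §5. The product state (Araki–Moriya Theorem 11.2) -/

section ProductState

variable {d d' : ℕ} {K : Type*} [DecidableEq K] (e : K × Site d' ≃ Site d)
  (ω : K → InfVolFermionState d') (hω : ∀ k, (ω k).IsEven)

/-- **The local product functional** `A ↦ τ(Π_k D_k · A)` on `𝔄_Λ` (product over the classes met by `Λ`).
[cite: ArakiMoriya2003, §11.1 Theorem 11.2 eq. (11.6)] -/
def tileExpect (Λ : Finset (Site d)) : FermionOp Λ →ₗ[ℂ] ℂ where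
  toFun A := normTrace (tileFactorProd e ω hω Λ (tileClasses e Λ) * A)
  map_add' A B := by rw [Matrix.mul_add, normTrace_add]
  map_smul' c A := by rw [Matrix.mul_smul, normTrace_smul, RingHom.id_apply, smul_eq_mul]

/-- Unfolding the product functional. [cite: ArakiMoriya2003, §11.1 Theorem 11.2 eq. (11.6)] -/
theorem tileExpect_apply (Λ : Finset (Site d)) (A : FermionOp Λ) :
    tileExpect e ω hω Λ A = normTrace (tileFactorProd e ω hω Λ (tileClasses e Λ) * A) := rfl

/-- **Product formula for the local functional**: on a product of observables of distinct tiles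
(a list of pairs (class, observable), classes pairwise distinct) it is the product of the component
expectations. [cite: ArakiMoriya2003, §11.1 Theorem 11.2 eq. (11.4)] -/
theorem tileExpect_prod_sigma (Λ : Finset (Site d)) (L : List (Σ k : K, FermionOp (tileLoc e Λ k)))
    (hL : (L.map Sigma.fst).Nodup) :
    tileExpect e ω hω Λ (L.map fun p => fermionEmbed (PolySite.tileEmb e Λ p.1) p.2).prod =
      (L.map fun p => (ω p.1).expect (tileLoc e Λ p.1) p.2).prod := by
  rw [tileExpect_apply, ← tileFactorProd_eq_of_subset e ω hω Λ (S := tileClasses e Λ ∪ (L.map Sigma.fst).toFinset)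
    Finset.subset_union_left (fun k _ hkT => tileLoc_eq_empty_of_notMem e hkT)]
  exact normTrace_tileFactorProd_mul_prod e ω hω Λ _ L hL
    (fun p hp => Finset.mem_union_right _ (List.mem_toFinset.2 (List.mem_map_of_mem hp)))

/-- Product formula, function form: `Π_{k ∈ l} Γ_k(a k) ↦ Π_{k ∈ l} ω_k(a k)` for a duplicate-free
list of classes `l`. [cite: ArakiMoriya2003, §11.1 Theorem 11.2 eq. (11.4)] -/
theorem tileExpect_prod (Λ : Finset (Site d)) (l : List K) (hl : l.Nodup) (a : (k : K) → FermionOp (tileLoc e Λ k)) :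
    tileExpect e ω hω Λ (l.map fun k => fermionEmbed (PolySite.tileEmb e Λ k) (a k)).prod =
      (l.map fun k => (ω k).expect (tileLoc e Λ k) (a k)).prod := by
  have h := tileExpect_prod_sigma e ω hω Λ (l.map fun k => (⟨k, a k⟩ : Σ k : K, FermionOp (tileLoc e Λ k)))
    (by simpa [List.map_map, Function.comp_def] using hl)
  rwa [List.map_map, List.map_map] at h

omit [DecidableEq K] in
/-- Isotony commutes with the legs: `Γ(Λ ⊆ Λ') ∘ Γ_k^{Λ} = Γ_k^{Λ'} ∘ Γ(tileLoc Λ k ⊆ tileLoc Λ' k)`.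
[cite: ArakiMoriya2003, §4.1 Def. 4.1 (2)] -/
theorem fermionEmbed_incl_fermionEmbed_tileEmb {Λ Λ' : Finset (Site d)} (h : Λ ⊆ Λ') (k : K)
    (a : FermionOp (tileLoc e Λ k)) :
    fermionEmbed (PolySite.incl h) (fermionEmbed (PolySite.tileEmb e Λ k) a) =
      fermionEmbed (PolySite.tileEmb e Λ' k) (fermionEmbed (PolySite.incl (tileLoc_mono e h k)) a) := by
  rw [fermionEmbed_fermionEmbed, fermionEmbed_fermionEmbed]
  exact congrFun (congrArg _ (fermionEmbed_congr (φ := (PolySite.tileEmb e Λ k).trans (PolySite.incl h))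
    (ψ := (PolySite.incl (tileLoc_mono e h k)).trans (PolySite.tileEmb e Λ' k)) fun y => rfl)) a

/-- **Compatibility with isotony** of the local product functionals (the restriction of the product
functional on `𝔄_{Λ'}` to `𝔄_Λ` is the product functional of `Λ`): checked on words, which factor
through the legs up to a common sign. [cite: ArakiMoriya2003, §11.1 Theorem 11.2 (Case 2: "the restriction of `φ^k` to `𝔄(I^l)` for `l < k` coincides with `φ^l`")] -/
theorem tileExpect_fermionEmbed_incl {Λ Λ' : Finset (Site d)} (h : Λ ⊆ Λ') (A : FermionOp Λ) :
    tileExpect e ω hω Λ' (fermionEmbed (PolySite.incl h) A) = tileExpect e ω hω Λ A := by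
  have hA : A ∈ Submodule.span ℂ {M | ∃ w : List (JWLetter (Orb (PolySite Λ))), LettersIn Finset.univ w ∧ wordOp w = M} :=
    mem_span_wordOp_of_mem_carSubalgebra (by rw [carSubalgebra_univ_eq_top]; exact Algebra.mem_top)
  refine Submodule.span_induction (p := fun A _ =>
    tileExpect e ω hω Λ' (fermionEmbed (PolySite.incl h) A) = tileExpect e ω hω Λ A) ?_ ?_ ?_ ?_ hA
  · rintro _ ⟨w, -, rfl⟩
    obtain ⟨n, a, hw⟩ := exists_wordOp_eq_sign_smul_prod_fermionEmbed e Λ (tileClasses e Λ').toList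
      (Finset.nodup_toList _) (fun x hx => Finset.mem_toList.2 (tileClasses_mono e h (tileClass_mem_tileClasses e hx))) w
    rw [hw, map_smul, map_smul, map_smul, map_list_prod, List.map_map,
      tileExpect_prod e ω hω Λ _ (Finset.nodup_toList _)]
    have hcomp : (fermionEmbed (PolySite.incl h) ∘ fun k => fermionEmbed (PolySite.tileEmb e Λ k) (a k)) =
        fun k => fermionEmbed (PolySite.tileEmb e Λ' k) (fermionEmbed (PolySite.incl (tileLoc_mono e h k)) (a k)) :=
      funext fun k => fermionEmbed_incl_fermionEmbed_tileEmb e h k (a k)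
    rw [hcomp, tileExpect_prod e ω hω Λ' _ (Finset.nodup_toList _)]
    congr 2
    exact List.map_congr_left fun k _ => (ω k).compatible (tileLoc_mono e h k) (a k)
  · rw [map_zero, map_zero, map_zero]
  · intro x y _ _ hx hy
    rw [map_add, map_add, hx, hy, map_add]
  · intro c x _ hx
    rw [map_smul, map_smul, hx, map_smul]

/-- The product density gives a nonnegative functional. [cite: ArakiMoriya2003, §11.1 Theorem 11.2] -/
theorem tileExpect_conjTranspose_mul_self_nonneg (Λ : Finset (Site d)) (A : FermionOp Λ) :
    0 ≤ tileExpect e ω hω Λ (Aᴴ * A) := by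
  rw [tileExpect_apply, normTrace_apply, ← Matrix.mul_assoc, Matrix.trace_mul_comm, ← Matrix.mul_assoc]
  have h := ((posSemidef_tileFactorProd e ω hω Λ (tileClasses e Λ)).mul_mul_conjTranspose_same A).trace_nonneg
  have h2 : (0 : ℂ) ≤ ((2 : ℂ) ^ Fintype.card (Orb (PolySite Λ)))⁻¹ := by
    have : ((2 : ℂ) ^ Fintype.card (Orb (PolySite Λ)))⁻¹ = (((2 : ℝ) ^ Fintype.card (Orb (PolySite Λ)))⁻¹ : ℝ) := by
      push_cast; rfl
    rw [this]
    exact Complex.zero_le_real.2 (by positivity)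
  rw [div_eq_mul_inv]
  exact mul_nonneg h h2

namespace InfVolFermionState

/-- **THE PRODUCT STATE** (Araki–Moriya 2003, Theorem 11.2; Powers' thesis Thm. 5.4) of the even
states `ω_k` of the lattice fermions on `ℤ^{d'}`, placed on the tiles of the tiling
`e : K × ℤ^{d'} ≃ ℤ^d`: the unique state of the CAR algebra over `ℤ^d` whose value on a product of
observables of distinct tiles is the product of the component expectations
(`productState_expect_prod`, uniqueness `eq_productState_of_forall_prod`). Locally it is
`A ↦ τ(Π_k D_k · A)` with `D_k` the leg-embedded adjusted density matrices, which commute because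
the `ω_k` are even. Instances: stacking copies of a `d'`-dimensional state into layers
(`K = ℤ`, `d = d' + 1`), decoupled sublattices of decorated lattices, films (vacuum factors).
[cite: ArakiMoriya2003, §11.1 Theorem 11.2] -/
def productState : InfVolFermionState d where
  expect := tileExpect e ω hω
  expect_one Λ := by rw [tileExpect_apply, Matrix.mul_one, normTrace_tileFactorProd]
  expect_nonneg Λ A := tileExpect_conjTranspose_mul_self_nonneg e ω hω Λ A
  compatible _ _ h A := tileExpect_fermionEmbed_incl e ω hω h A

/-- The local expectations of the product state (definitional). [cite: ArakiMoriya2003, §11.1 Theorem 11.2 eq. (11.6)] -/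
theorem productState_expect (Λ : Finset (Site d)) (A : FermionOp Λ) :
    (productState e ω hω).expect Λ A = normTrace (tileFactorProd e ω hω Λ (tileClasses e Λ) * A) := rfl

/-- **Product property** (Araki–Moriya (11.4)): for distinct classes `k ∈ l` and observables
`a_k` of the tiles, `ω̃(Π_{k ∈ l} Γ_k a_k) = Π_{k ∈ l} ω_k(a_k)`. [cite: ArakiMoriya2003, §11.1 Theorem 11.2 eq. (11.4)] -/
theorem productState_expect_prod (Λ : Finset (Site d)) (l : List K) (hl : l.Nodup)
    (a : (k : K) → FermionOp (tileLoc e Λ k)) :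
    (productState e ω hω).expect Λ (l.map fun k => fermionEmbed (PolySite.tileEmb e Λ k) (a k)).prod =
      (l.map fun k => (ω k).expect (tileLoc e Λ k) (a k)).prod :=
  tileExpect_prod e ω hω Λ l hl a

/-- Product states of equal families of factors are equal (the evenness witnesses are irrelevant).
[cite: ArakiMoriya2003, §11.1 Theorem 11.2] -/
theorem productState_congr {ω ω' : K → InfVolFermionState d'} {hω : ∀ k, (ω k).IsEven} {hω' : ∀ k, (ω' k).IsEven}
    (h : ω = ω') : productState e ω hω = productState e ω' hω' := by
  subst h
  rfl

/-- Product property, pair form (a list of (class, observable) pairs with pairwise distinct classes).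
[cite: ArakiMoriya2003, §11.1 Theorem 11.2 eq. (11.4)] -/
theorem productState_expect_prod_sigma (Λ : Finset (Site d)) (L : List (Σ k : K, FermionOp (tileLoc e Λ k)))
    (hL : (L.map Sigma.fst).Nodup) :
    (productState e ω hω).expect Λ (L.map fun p => fermionEmbed (PolySite.tileEmb e Λ p.1) p.2).prod =
      (L.map fun p => (ω p.1).expect (tileLoc e Λ p.1) p.2).prod :=
  tileExpect_prod_sigma e ω hω Λ L hL

/-- **One tile**: `ω̃(Γ_k a) = ω_k(a)` — the restriction of the product state to the `k`-th tile is
`ω_k`. [cite: ArakiMoriya2003, §11.1 Theorem 11.2 eq. (11.4)] -/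
theorem productState_expect_fermionEmbed (Λ : Finset (Site d)) (k : K) (a : FermionOp (tileLoc e Λ k)) :
    (productState e ω hω).expect Λ (fermionEmbed (PolySite.tileEmb e Λ k) a) = (ω k).expect (tileLoc e Λ k) a := by
  have h := productState_expect_prod_sigma e ω hω Λ [⟨k, a⟩] (List.nodup_singleton k)
  rwa [List.map_singleton, List.prod_singleton, List.map_singleton, List.prod_singleton] at h

/-- **Two tiles**: `ω̃(Γ_k a · Γ_j b) = ω_k(a) ω_j(b)` for `k ≠ j`; in particular a product of an
odd observable of one tile with any observable of another has zero expectation (even factors).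
[cite: ArakiMoriya2003, §11.1 Theorem 11.2 eq. (11.4)] -/
theorem productState_expect_fermionEmbed_mul_fermionEmbed (Λ : Finset (Site d)) {k j : K} (hkj : k ≠ j)
    (a : FermionOp (tileLoc e Λ k)) (b : FermionOp (tileLoc e Λ j)) :
    (productState e ω hω).expect Λ (fermionEmbed (PolySite.tileEmb e Λ k) a * fermionEmbed (PolySite.tileEmb e Λ j) b) =
      (ω k).expect (tileLoc e Λ k) a * (ω j).expect (tileLoc e Λ j) b := by
  have h := productState_expect_prod_sigma e ω hω Λ [⟨k, a⟩, ⟨j, b⟩]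
    (by rw [List.map_cons, List.map_singleton]; exact List.nodup_cons.2 ⟨by simpa using hkj, List.nodup_singleton j⟩)
  simpa only [List.map_cons, List.map_nil, List.prod_cons, List.prod_nil, mul_one] using h

/-- An odd observable of one tile times any observable of another tile has zero expectation.
[cite: ArakiMoriya2003, §4.1 eq. (4.8) and §11.1 Theorem 11.2] -/
theorem productState_expect_fermionEmbed_mul_fermionEmbed_of_odd (Λ : Finset (Site d)) {k j : K} (hkj : k ≠ j)
    {a : FermionOp (tileLoc e Λ k)} (ha : parityAut a = -a) (b : FermionOp (tileLoc e Λ j)) :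
    (productState e ω hω).expect Λ (fermionEmbed (PolySite.tileEmb e Λ k) a * fermionEmbed (PolySite.tileEmb e Λ j) b) = 0 := by
  rw [productState_expect_fermionEmbed_mul_fermionEmbed e ω hω Λ hkj, (hω k).expect_eq_zero_of_odd ha, zero_mul]

/-- **The `k`-th marginal is `ω_k`**: pulling the product state back along the `k`-th leg returns the
`k`-th factor. [cite: ArakiMoriya2003, §11.1 Theorem 11.2] -/
theorem productState_mapAct (k : K) :
    (productState e ω hω).mapAct (tileLeg e k) (tileLeg_injective e k) = ω k := by
  refine InfVolFermionState.ext fun X => LinearMap.ext fun a => ?_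
  have hsub : X ⊆ tileLoc e (mapSet (tileLeg e k) X) k := fun y hy => (mem_tileLoc e).2 (mem_mapSet_of_mem _ hy)
  rw [mapAct_expect, fermionEmbed_congr (φ := PolySite.mapEmb (tileLeg e k) (tileLeg_injective e k) X)
    (ψ := (PolySite.incl hsub).trans (PolySite.tileEmb e (mapSet (tileLeg e k) X) k)) (fun y => rfl),
    ← fermionEmbed_fermionEmbed, productState_expect_fermionEmbed, (ω k).compatible hsub]

/-- **The product state of even states is even** (Araki–Moriya Thm. 11.2, Remark 2).
[cite: ArakiMoriya2003, §11.1 Theorem 11.2 Remark 2] -/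
theorem productState_isEven : (productState e ω hω).IsEven := fun Λ A => by
  rw [productState_expect, productState_expect, normTrace_mul_parityAut, parityAut_tileFactorProd]

/-- **Uniqueness** (Araki–Moriya Thm. 11.2): a state with the product property on the leg-embedded
observables of the tiles IS the product state (the class-sorted monomials are total).
[cite: ArakiMoriya2003, §11.1 Theorem 11.2 ("When such `φ` exists, it is unique")] -/
theorem eq_productState_of_forall_prod {ν : InfVolFermionState d}
    (hν : ∀ (Λ : Finset (Site d)) (l : List K), l.Nodup → (∀ k ∈ l, k ∈ tileClasses e Λ) →
      ∀ a : (k : K) → FermionOp (tileLoc e Λ k),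
        ν.expect Λ (l.map fun k => fermionEmbed (PolySite.tileEmb e Λ k) (a k)).prod =
          (l.map fun k => (ω k).expect (tileLoc e Λ k) (a k)).prod) :
    ν = productState e ω hω := by
  refine InfVolFermionState.ext fun Λ => LinearMap.ext fun A => ?_
  have hA : A ∈ Submodule.span ℂ {M | ∃ w : List (JWLetter (Orb (PolySite Λ))), LettersIn Finset.univ w ∧ wordOp w = M} :=
    mem_span_wordOp_of_mem_carSubalgebra (by rw [carSubalgebra_univ_eq_top]; exact Algebra.mem_top)
  refine Submodule.span_induction (p := fun A _ => ν.expect Λ A = (productState e ω hω).expect Λ A) ?_ ?_ ?_ ?_ hA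
  · rintro _ ⟨w, -, rfl⟩
    obtain ⟨n, a, hw⟩ := exists_wordOp_eq_sign_smul_prod_fermionEmbed e Λ (tileClasses e Λ).toList
      (Finset.nodup_toList _) (fun x hx => Finset.mem_toList.2 (tileClass_mem_tileClasses e hx)) w
    rw [hw, map_smul, map_smul, hν Λ _ (Finset.nodup_toList _) (fun k hk => Finset.mem_toList.1 hk) a,
      productState_expect_prod e ω hω Λ _ (Finset.nodup_toList _)]
  · rw [map_zero, map_zero]
  · intro x y _ _ hx hy
    rw [map_add, map_add, hx, hy]
  · intro c x _ hx
    rw [map_smul, map_smul, hx]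

omit [DecidableEq K] in
/-- Translating a leg-embedded observable: `Γ(τ_v) Γ_k^{Λ} a = Γ_{σ k}^{Λ+v} Γ(⊆) Γ(τ_{c_k}) a` when the
translation `τ_v` of `ℤ^d` maps tile `k` onto tile `σ k` acting as `τ_{c_k}` in local coordinates.
[cite: ArakiMoriya2003, §4.1 Def. 4.3] -/
theorem shiftSet_tileLoc_subset (v : Site d) (σ : K → K) (c : K → Site d')
    (hv : ∀ k y, tileLeg e k y + v = tileLeg e (σ k) (y + c k)) (Λ : Finset (Site d)) (k : K) :
    shiftSet (c k) (tileLoc e Λ k) ⊆ tileLoc e (shiftSet v Λ) (σ k) := fun y hy => by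
  rw [mem_tileLoc, mem_shiftSet, ← sub_add_cancel y (c k), ← hv, add_sub_cancel_right, ← mem_tileLoc e]
  exact mem_shiftSet.1 hy

omit [DecidableEq K] in
/-- The translate of a leg-embedded observable is a leg-embedded observable of the translated region.
[cite: ArakiMoriya2003, §4.1 Def. 4.3] -/
theorem fermionEmbed_shiftEmb_fermionEmbed_tileEmb (v : Site d) (σ : K → K) (c : K → Site d')
    (hv : ∀ k y, tileLeg e k y + v = tileLeg e (σ k) (y + c k)) (Λ : Finset (Site d)) (k : K)
    (a : FermionOp (tileLoc e Λ k)) :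
    fermionEmbed (PolySite.shiftEmb v Λ) (fermionEmbed (PolySite.tileEmb e Λ k) a) =
      fermionEmbed (PolySite.tileEmb e (shiftSet v Λ) (σ k))
        (fermionEmbed (PolySite.incl (shiftSet_tileLoc_subset e v σ c hv Λ k))
          (fermionEmbed (PolySite.shiftEmb (c k) (tileLoc e Λ k)) a)) := by
  rw [fermionEmbed_fermionEmbed, fermionEmbed_fermionEmbed, fermionEmbed_fermionEmbed]
  exact congrFun (congrArg _ (fermionEmbed_congr
    (φ := (PolySite.tileEmb e Λ k).trans (PolySite.shiftEmb v Λ))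
    (ψ := ((PolySite.shiftEmb (c k) (tileLoc e Λ k)).trans (PolySite.incl (shiftSet_tileLoc_subset e v σ c hv Λ k))).trans
      (PolySite.tileEmb e (shiftSet v Λ) (σ k)))
    fun y => Subtype.ext (by
      simp only [Function.Embedding.trans_apply, PolySite.coe_shiftEmb, PolySite.coe_tileEmb_eq, PolySite.coe_incl,
        ofLex_toLex, hv]))) a

/-- **Translation covariance**: if the lattice translation `τ_v` maps tile `k` onto tile `σ k`
(`σ` injective), acting as the translation `τ_{c_k}` in local coordinates, then
`(⊗_k ω_k) ∘ τ_v = ⊗_k (ω_{σ k} ∘ τ_{c_k})`. [cite: ArakiMoriya2003, §4.1 Def. 4.3 and §11.1 Theorem 11.2 (uniqueness)] -/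
theorem productState_shift (v : Site d) (σ : K → K) (hσ : Function.Injective σ) (c : K → Site d')
    (hv : ∀ k y, tileLeg e k y + v = tileLeg e (σ k) (y + c k)) :
    (productState e ω hω).shift v =
      productState e (fun k => (ω (σ k)).shift (c k)) (fun k => (hω (σ k)).shift (c k)) := by
  refine eq_productState_of_forall_prod e _ _ fun Λ l hl _ a => ?_
  rw [shift_expect, map_list_prod, List.map_map]
  have hcomp : (fermionEmbed (PolySite.shiftEmb v Λ) ∘ fun k => fermionEmbed (PolySite.tileEmb e Λ k) (a k)) =
      fun k => fermionEmbed (PolySite.tileEmb e (shiftSet v Λ) (σ k))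
        (fermionEmbed (PolySite.incl (shiftSet_tileLoc_subset e v σ c hv Λ k))
          (fermionEmbed (PolySite.shiftEmb (c k) (tileLoc e Λ k)) (a k))) :=
    funext fun k => fermionEmbed_shiftEmb_fermionEmbed_tileEmb e v σ c hv Λ k (a k)
  rw [hcomp]
  have h := productState_expect_prod_sigma e ω hω (shiftSet v Λ)
    (l.map fun k => (⟨σ k, fermionEmbed (PolySite.incl (shiftSet_tileLoc_subset e v σ c hv Λ k))
      (fermionEmbed (PolySite.shiftEmb (c k) (tileLoc e Λ k)) (a k))⟩ : Σ j : K, FermionOp (tileLoc e (shiftSet v Λ) j)))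
    (by rw [List.map_map]; exact hl.map fun x y h => hσ h)
  rw [List.map_map, List.map_map] at h
  rw [show (fun k => fermionEmbed (PolySite.tileEmb e (shiftSet v Λ) (σ k))
        (fermionEmbed (PolySite.incl (shiftSet_tileLoc_subset e v σ c hv Λ k))
          (fermionEmbed (PolySite.shiftEmb (c k) (tileLoc e Λ k)) (a k)))) =
      ((fun p : (Σ j : K, FermionOp (tileLoc e (shiftSet v Λ) j)) => fermionEmbed (PolySite.tileEmb e (shiftSet v Λ) p.1) p.2) ∘
        fun k => (⟨σ k, fermionEmbed (PolySite.incl (shiftSet_tileLoc_subset e v σ c hv Λ k))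
          (fermionEmbed (PolySite.shiftEmb (c k) (tileLoc e Λ k)) (a k))⟩ : Σ j : K, FermionOp (tileLoc e (shiftSet v Λ) j)))
      from rfl, h]
  refine congrArg List.prod (List.map_congr_left fun k _ => ?_)
  simp only [Function.comp_apply]
  rw [(ω (σ k)).compatible, shift_expect]

/-- **Translation invariance**: if every lattice translation permutes the tiles (injectively) acting
by translations in local coordinates, and the factors are correspondingly related
(`ω_{σ_v k} ∘ τ_{c_v k} = ω_k`), the product state is translation invariant — e.g. identical
translation-invariant factors stacked in layers. [cite: ArakiMoriya2003, §4.1 Def. 4.5] -/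
theorem productState_isTranslationInvariant (σ : Site d → K → K) (hσ : ∀ v, Function.Injective (σ v))
    (c : Site d → K → Site d') (hv : ∀ v k y, tileLeg e k y + v = tileLeg e (σ v k) (y + c v k))
    (hωv : ∀ v k, (ω (σ v k)).shift (c v k) = ω k) : (productState e ω hω).IsTranslationInvariant := by
  intro v
  rw [productState_shift e ω hω v (σ v) (hσ v) (c v) (hv v)]
  exact productState_congr e (funext (hωv v))

end InfVolFermionState

/-- **The density transfers along a pullback**: `ρ_{ν ∘ Γ_f}(y) = ρ_ν(f y)`. [cite: ArakiMoriya2003, §4.1] -/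
theorem InfVolFermionState.densityAt_mapAct (ν : InfVolFermionState d) (f : Site d' → Site d) (hf : Function.Injective f)
    (y : Site d') : (ν.mapAct f hf).densityAt y = ν.densityAt (f y) := by
  have hmem : f y ∈ mapSet f ({y} : Finset (Site d')) := mem_mapSet_of_mem f (mem_singleton_self y)
  have hsub : ({f y} : Finset (Site d)) ⊆ mapSet f ({y} : Finset (Site d')) := singleton_subset_iff.2 hmem
  have hn : ∀ τ : Fin 2, fermionEmbed (PolySite.mapEmb f hf ({y} : Finset (Site d')))
      (nAt y (mem_singleton_self y) τ) =
        fermionEmbed (PolySite.incl hsub) (nAt (f y) (mem_singleton_self (f y)) τ) := by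
    intro τ
    rw [nAt, nAt, fermionEmbed_numberOp, fermionEmbed_numberOp, PolySite.mapEmb_pt, PolySite.incl_pt]
  rw [InfVolFermionState.densityAt, InfVolFermionState.densityAt, InfVolFermionState.mapAct_expect, map_add, hn 0, hn 1,
    ← map_add, ν.compatible hsub]

/-- **Densities of the product state**: at a site of tile `k` with local coordinate `y` the density
is `ρ_{ω_k}(y)`. [cite: ArakiMoriya2003, §11.1 Theorem 11.2] -/
theorem InfVolFermionState.densityAt_productState (k : K) (y : Site d') :
    (InfVolFermionState.productState e ω hω).densityAt (tileLeg e k y) = (ω k).densityAt y := by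
  rw [← InfVolFermionState.densityAt_mapAct _ (tileLeg e k) (tileLeg_injective e k), InfVolFermionState.productState_mapAct]

end ProductState
end Literature.MathematicalPhysics.QuantumLattice
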